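import Literature.AnabelianGeometry.AbsoluteAnabelian.GaloisCyclotomeTransportNaturality
import Literature.AnabelianGeometry.AbsoluteAnabelian.AbsTopIII.ReconstructionCor110iiPrime
import Literature.NumberTheory.GaloisRepresentations.ContinuousCohomologyConnecting
import HarnessLib

/-!
# [AbsTopIII] Cor. 1.10 (i)(b), NATURAL form — the cyclotome square
# `Ẑ(1)(ψ̄_α) ∘ (μ_Ẑ(G_{k₁}) ≅ Ẑ(1)(k̄₁)) = (μ_Ẑ(G_{k₂}) ≅ Ẑ(1)(k̄₂)) ∘ μ_Ẑ(α)` on continuous crossed homomorphisms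

Mochizuki, *Topics in Absolute Anabelian Geometry III*, Cor. 1.10 (i) p. 42 (manuscript pagination, lit
key `paper:url-5493eb38cbb7`): the cyclotome `μ_Ẑ(G_k)` is constructed «group-theoretically» and the
algorithm is «functorial»; [AbsAnab] Prop. 1.2.1 (vi) p. 10: «The morphisms induced by `α` on the
abelianizations … induce an isomorphism `μ_{ℚ/ℤ}(K̄₁) ⥲ μ_{ℚ/ℤ}(K̄₂)` which is Galois-equivariant with
respect to `α`».

CYCLOTOME LEG of the naturality closer of abc-iut-L4-d1's `AbsTopIII.Cor_1_10_i_b_natural`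
(`ReconstructionCor110iiPrime.lean`, reading (N)); abc-iut cell, layer L4, row «Cor110ib-NAT»
(abc-iut-L4-d3).  For non-archimedean local fields `k₁, k₂` (valued form, universe `0`), torsion
reciprocity data `Dᵢ : TorsionReciprocityData kᵢ` ([AbsAnab] Prop. 1.2.1 (vi): `μ_{ℚ/ℤ}(G_k) ≅ μ(k̄)`),
`α : G_{k₁} ≃ₜ* G_{k₂}` and a multiplicative `ψ̄ : k̄₁ˣ ⥲ k̄₂ˣ` TRANSPORTING the data
(`D₂.muLift ∘ μ_{ℚ/ℤ}(α) = ψ̄ ∘ D₁.muLift`; for the LCFT data and THE units transport this is abc-iut-L6-t11's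
`TorsionReciprocityData.theta_transport_of_levelChar` + `toMul_muLift_map_of_level`):

* `muVal_toTateModule_congrL` — abc-iut-L4-t11's identification `toTateModule k D.equiv : μ_Ẑ(G_k) → Ẑ(1)(k̄)`
  (`GaloisCyclotomeTateModule.lean`) intertwines `μ_Ẑ(α)` (abc-iut-L4-d1's `MuZhatMod.congrL α`) with
  `ψ̄` levelwise: `(i₂ (μ_Ẑ(α) m))_n = ψ̄ ((i₁ m)_n)` in `μ_n(k̄₂)`;
* `galCyclotomeH1Map_oneCocycleClass` — `H¹(α; μ_Ẑ(α)) [c] = [μ_Ẑ(α) ∘ c ∘ α⁻¹]` on continuous crossed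
  homomorphisms (Mathlib functoriality, `map_oneCocycleClass`);
* `muVal_tateCocycle_transport` — the crossed homomorphisms `i₁ ∘ c` of `Ẑ(1)(k̄₁)` and
  `i₂ ∘ (μ_Ẑ(α) ∘ c ∘ α⁻¹)` of `Ẑ(1)(k̄₂)` are related levelwise by `ψ̄` along `α⁻¹` — the input shape of the
  Kummer square (abc-iut-L4-d1, squares (2)+(3)).

Proof-only (theorems; no definitions, no named facts, no `sorry`).  HONEST FRAMING: classical (Kummer
theory / LCFT bookkeeping); [AbsTopIII]/[AbsAnab] are refereed papers; nothing here bears on [IUTchIII]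
Cor. 3.12 or takes a side; typed ≠ proved.
-/

noncomputable section

open CategoryTheory Function
open Field IsNonarchimedeanLocalField ValuativeRel

namespace Literature.AnabelianGeometry.AbsoluteAnabelian

open _root_.TopRep _root_.ContRepresentation _root_.ContinuousCohomology
open Literature.NumberTheory.GaloisRepresentations
open Literature.NumberTheory.GaloisRepresentations.DiscreteGaloisModule

namespace Cor110Nat

/-! ### The identification `μ_Ẑ(G_k) ≅ Ẑ(1)(k̄)` intertwines `μ_Ẑ(α)` with `ψ̄` -/

section Levels

variable {K₁ K₂ : Type} [Field K₁] [CharZero K₁] [Field K₂] [CharZero K₂]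

/-- **Levelwise transport of the Tate-module identification** ([AbsAnab] Prop. 1.2.1 (vi): the
identification `μ_{ℚ/ℤ}(G_k) ≅ μ(k̄)` «is Galois-equivariant with respect to `α`»): if the torsion
reciprocity data `D₁, D₂` are transported by `(α, ψ̄)` on `μ_{ℚ/ℤ}` (`D₂.muLift (μ_{ℚ/ℤ}(α) z) = ψ̄ (D₁.muLift z)`),
then abc-iut-L4-t11's `toTateModule kᵢ Dᵢ.equiv : μ_Ẑ(G_{kᵢ}) → Ẑ(1)(k̄ᵢ)` satisfy, at every level `n`,
`(i₂ (μ_Ẑ(α) m))_n = ψ̄ ((i₁ m)_n)` as units of `k̄₂`. [cite: MochizukiAbsAnab2004, Prop 1.2.1 (vi) p.10] -/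
theorem muVal_toTateModule_congrL (D₁ : TorsionReciprocityData K₁) (D₂ : TorsionReciprocityData K₂)
    (α : absoluteGaloisGroup K₁ ≃ₜ* absoluteGaloisGroup K₂)
    (ψ : (AlgebraicClosure K₁)ˣ ≃* (AlgebraicClosure K₂)ˣ)
    (hμ : ∀ z : muQZ (absoluteGaloisGroup K₁),
      Additive.toMul (D₂.muLift (muQZ.map α z)) = ψ (Additive.toMul (D₁.muLift z)))
    (m : MuZhatMod (absoluteGaloisGroup K₁)) (n : ℕ+) :
    muVal K₂ n ((toTateModule K₂ D₂.equiv (MuZhatMod.congrL α m) : ∀ n : ℕ+, MuCarrier K₂ n) n) =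
      ψ (muVal K₁ n ((toTateModule K₁ D₁.equiv m : ∀ n : ℕ+, MuCarrier K₁ n) n)) := by
  rw [muVal_toTateModule, muVal_toTateModule]
  unfold levelUnit
  rw [MuZhatMod.toMuZhat_congrL, muZhat.map_apply_coe, toAdd_ofAdd]
  change (((Additive.toMul (D₂.muTorsionHom _) : CommGroup.torsion (AlgebraicClosure K₂)ˣ) :
      (AlgebraicClosure K₂)ˣ)) =
    ψ ((Additive.toMul (D₁.muTorsionHom _) : CommGroup.torsion (AlgebraicClosure K₁)ˣ) :
      (AlgebraicClosure K₁)ˣ)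
  rw [TorsionReciprocityData.coe_muTorsionHom, TorsionReciprocityData.coe_muTorsionHom]
  exact hμ _

end Levels

/-! ### `H¹(α; μ_Ẑ(α))` and the transported crossed homomorphisms -/

section Cocycles

variable {K₁ K₂ : Type} [Field K₁] [CharZero K₁] [Field K₂] [CharZero K₂]

/-- **`H¹(α; μ_Ẑ(α)) [c] = [μ_Ẑ(α) ∘ c ∘ α⁻¹]`**: abc-iut-L4-d1's `galCyclotomeH1Map α` (Mathlib
`ContinuousCohomology.map α⁻¹ (galCyclotomeResHom α)`) on the class of a continuous crossed homomorphism
`c : G_{k₁} → μ_Ẑ(G_{k₁})` is the class of its transport (Mathlib functoriality on explicit cocycles, the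
tree's `map_oneCocycleClass`). [cite: MochizukiAbsTopIII2015, Cor 1.10 (i) p.42] -/
theorem galCyclotomeH1Map_oneCocycleClass
    {G : Type} [Group G] [TopologicalSpace G] [IsTopologicalGroup G] [CompactSpace G]
    {G' : Type} [Group G'] [TopologicalSpace G'] [IsTopologicalGroup G'] [CompactSpace G']
    (α : G ≃ₜ* G') (c : contOneCocycles (galCyclotomeTopRep G)) :
    galCyclotomeH1Map α (oneCocycleClass _ c) =
      oneCocycleClass (galCyclotomeTopRep G')
        (contOneCocycles.pullback (α.symm : G' →ₜ* G) (galCyclotomeResHom α) c) := by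
  change (ContinuousCohomology.map (α.symm : G' →ₜ* G) (galCyclotomeResHom α) 1).hom.toLinearMap.toAddMonoidHom
      (oneCocycleClass _ c) = _
  exact map_oneCocycleClass _ _ _ c

/-- Values of the transported crossed homomorphism: `(μ_Ẑ(α) ∘ c ∘ α⁻¹)(σ') = μ_Ẑ(α) (c (α⁻¹ σ'))`.
[cite: MochizukiAbsTopIII2015, Cor 1.10 (i) p.42] -/
theorem pullback_galCyclotomeResHom_apply
    {G : Type} [Group G] [TopologicalSpace G] [IsTopologicalGroup G] [CompactSpace G]
    {G' : Type} [Group G'] [TopologicalSpace G'] [IsTopologicalGroup G'] [CompactSpace G']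
    (α : G ≃ₜ* G') (c : contOneCocycles (galCyclotomeTopRep G)) (σ' : G') :
    (contOneCocycles.pullback (α.symm : G' →ₜ* G) (galCyclotomeResHom α) c).1 σ' =
      MuZhatMod.congrL α (c.1 (α.symm σ')) :=
  rfl

/-- Values of `i ∘ c`: the crossed homomorphism of `Ẑ(1)(k̄)` obtained from `c : G_k → μ_Ẑ(G_k)` through
abc-iut-L4-t11's `galCyclotomeIsoTateModule k D.equiv D.equiv_smul` is `σ ↦ toTateModule k D.equiv (c σ)`.
[cite: MochizukiAbsTopIII2015, Cor 1.10 (i) p.42] -/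
theorem pullback_galCyclotomeIsoTateModule_apply (D : TorsionReciprocityData K₁)
    (c : contOneCocycles (galCyclotomeTopRep (absoluteGaloisGroup K₁))) (σ : absoluteGaloisGroup K₁) :
    haveI : CompactSpace (absoluteGaloisGroup K₁) := absoluteGaloisGroup_compactSpace K₁
    (contOneCocycles.pullback (ContinuousMonoidHom.id (absoluteGaloisGroup K₁))
        (resIdHom (galCyclotomeIsoTateModule K₁ D.equiv D.equiv_smul).hom) c).1 σ =
      toTateModule K₁ D.equiv (c.1 σ) :=
  rfl

/-- **The input shape of the Kummer square.**  For transported torsion reciprocity data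
(`D₂.muLift (μ_{ℚ/ℤ}(α) z) = ψ̄ (D₁.muLift z)`) and a continuous crossed homomorphism
`c : G_{k₁} → μ_Ẑ(G_{k₁})`, the crossed homomorphisms `d₁ := i₁ ∘ c` of `Ẑ(1)(k̄₁)` and
`d₂ := i₂ ∘ (μ_Ẑ(α) ∘ c ∘ α⁻¹)` of `Ẑ(1)(k̄₂)` are related LEVELWISE by `ψ̄` along `α⁻¹`:
`(d₂ σ')_n = ψ̄ ((d₁ (α⁻¹ σ'))_n)` in `k̄₂ˣ` for every `σ' ∈ G_{k₂}` and `n ≥ 1` ([AbsAnab] Prop. 1.2.1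
(vi) «Galois-equivariant with respect to `α`», read on cocycles). [cite: MochizukiAbsAnab2004, Prop 1.2.1 (vi) p.10] -/
theorem muVal_tateCocycle_transport (D₁ : TorsionReciprocityData K₁) (D₂ : TorsionReciprocityData K₂)
    (α : absoluteGaloisGroup K₁ ≃ₜ* absoluteGaloisGroup K₂)
    (ψ : (AlgebraicClosure K₁)ˣ ≃* (AlgebraicClosure K₂)ˣ)
    (hμ : ∀ z : muQZ (absoluteGaloisGroup K₁),
      Additive.toMul (D₂.muLift (muQZ.map α z)) = ψ (Additive.toMul (D₁.muLift z)))
    (c : contOneCocycles (galCyclotomeTopRep (absoluteGaloisGroup K₁)))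
    (σ' : absoluteGaloisGroup K₂) (n : ℕ+) :
    haveI : CompactSpace (absoluteGaloisGroup K₁) := absoluteGaloisGroup_compactSpace K₁
    haveI : CompactSpace (absoluteGaloisGroup K₂) := absoluteGaloisGroup_compactSpace K₂
    muVal K₂ n (((contOneCocycles.pullback (ContinuousMonoidHom.id (absoluteGaloisGroup K₂))
        (resIdHom (galCyclotomeIsoTateModule K₂ D₂.equiv D₂.equiv_smul).hom)
        (contOneCocycles.pullback (α.symm : absoluteGaloisGroup K₂ →ₜ* absoluteGaloisGroup K₁)
          (galCyclotomeResHom α) c)).1 σ' : ∀ n : ℕ+, MuCarrier K₂ n) n) =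
      ψ (muVal K₁ n (((contOneCocycles.pullback (ContinuousMonoidHom.id (absoluteGaloisGroup K₁))
        (resIdHom (galCyclotomeIsoTateModule K₁ D₁.equiv D₁.equiv_smul).hom) c).1 (α.symm σ') :
          ∀ n : ℕ+, MuCarrier K₁ n) n)) := by
  haveI : CompactSpace (absoluteGaloisGroup K₁) := absoluteGaloisGroup_compactSpace K₁
  haveI : CompactSpace (absoluteGaloisGroup K₂) := absoluteGaloisGroup_compactSpace K₂
  rw [pullback_galCyclotomeIsoTateModule_apply, pullback_galCyclotomeIsoTateModule_apply,
    pullback_galCyclotomeResHom_apply]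
  exact muVal_toTateModule_congrL D₁ D₂ α ψ hμ _ n

end Cocycles

end Cor110Nat

end Literature.AnabelianGeometry.AbsoluteAnabelian
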